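import Summits.Langlands.Langlands.Theses.SteinbergArtinDedekind
import Summits.Langlands.Langlands.Theorems.SteinbergArtinDedekindSteinbergCongruenceSymPow
import Summits.Langlands.Langlands.Theorems.SteinbergArtinDedekindSteinbergCongruenceProjectiveLine
import Literature.AlgebraicGeometry.Motives.FrobeniusTraceProofs
import HarnessLib

/-!
# `SteinbergArtinDedekind.SteinbergCongruence` (stmt-Langlands-11804) — proved

[proof of `Summit.Langlands.Langlands.Theses.SteinbergArtinDedekind.SteinbergCongruence`
(route `SteinbergArtinDedekind`, support item, rank 9)]

**Statement.**  Let `ℓ` be prime, `ρ̄ : Γ_ℚ → GL₂(𝔽_ℓ)` and `σ : Γ_ℚ → GL_ℓ(ℂ)` continuous, and suppose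
`σ` has the Steinberg character of `ρ̄`: `tr σ(g) = #{w ≠ 0 : ρ̄(g)w ∈ 𝔽_ℓ w}/(ℓ − 1) − 1` for all `g`.
Then for every `g` there is `Q ∈ ℤ[X]` with `Q ↦ charpoly σ(g)` in `ℂ[X]` and, for every field
`k ⊇ 𝔽_ℓ` and `a, b ∈ k` with `charpoly ρ̄(g) = (X − a)(X − b)` in `k[X]`,
`Q ↦ ∏_{i=0}^{ℓ−1} (X − a^i b^{ℓ−1−i})` in `k[X]` — the Brauer–Nesbitt form of `St_ℓ ⊗ 𝔽_ℓ ≅ Sym^{ℓ−1}`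
(`St = L(ℓ−1)` in the defining characteristic).

**Proof (one object, three coefficient rings — no case analysis on the four class types of `GL₂(𝔽_ℓ)`).**
Put `x = ρ̄(g) ∈ GL₂(𝔽_ℓ)` and let `N_R ∈ M_{ℓ+1}(R)` be the permutation matrix of `x` acting on the
projective line `ℙ¹(𝔽_ℓ)` (`R` any commutative ring; entries `[x·j = i]`, so `N_R = N_ℤ ⊗ R`, §A).
* (ℂ, §B/§E) `tr N_ℂ^m = #Fix_{ℙ¹}(x^m)` and, by the hypothesis at `g^m` together with
  `#{eigenvectors ≠ 0} = #{stable lines}·(ℓ − 1)` (`nat_card_eigenvectors_eq'`),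
  `#Fix(x^m) = tr σ(g^m) + 1 = tr (σ(g) ⊕ 1)^m`.  Deligne's identity
  `det(1 − tA) = exp(−∑ tr(A^m) t^m/m)` (`FrobeniusTrace.exp_subst_traceLogSeries_mul_charpolyRev`,
  cited BY NAME) turns equal power traces into equal characteristic polynomials:
  `charpoly N_ℂ = charpoly σ(g) · (X − 1)`.
* (ℤ, §E) Hence `1` is a root of `charpoly N_ℤ` and `Q := charpoly N_ℤ /ₘ (X − 1) ∈ ℤ[X]` maps to
  `charpoly σ(g)` (cancel the monic `X − 1` in `ℂ[X]`).
* (k ⊇ 𝔽_ℓ, §C–§D) `charpoly N_k = charpoly N_kᵀ = charpoly N_k(x⁻¹)` is the characteristic polynomial of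
  `x⁻¹` on `k[ℙ¹(𝔽_ℓ)]`, computed in an ADAPTED basis: the evaluation map
  `Ψ : Sym^{ℓ−1} k² = k[X₀,X₁]_{ℓ−1} → k[ℙ¹(𝔽_ℓ)]`, `Ψ(F)(L) = F(L)` (well defined since `c^{ℓ−1} = 1` on
  `𝔽_ℓˣ`) is injective (a form of degree `ℓ − 1` vanishing at the `ℓ` points `(t:1)` is `0`), satisfies
  `x⁻¹·Ψ(F) = Ψ(F(X·(ιx)ᵀ))`, and lands in the augmentation kernel (`∑_L F(L) = 0`: the non-zero vectors
  fibre over the lines with fibres of size `ℓ − 1 ≡ −1`, `F(0) = 0`, and `∑_{v ∈ 𝔽_ℓ²} F(v) = 0`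
  monomial by monomial because `∑_{s ∈ 𝔽_ℓ} s^d = 0` for `d < ℓ − 1`), while the augmentation of `𝟙` is
  `ℓ + 1 = 1 ≠ 0`; so `(Ψ(m_j))_j, 𝟙` is a basis (`ℓ + 1` independent vectors) in which `x⁻¹` is
  `Sym^{ℓ−1}((ιx)ᵀ) ⊕ 1` — the special (trivial) constituent splits off the generic one `Sym^{ℓ−1}`.
  Finally `charpoly Sym^r(y) = ∏_{i=0}^{r} (X − a^i b^{r−i})` whenever `charpoly y = (X − a)(X − b)` (§C:
  triangularise the `2 × 2` matrix `y` explicitly, conjugation invariance by functoriality of `Sym^r` on the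
  matrix monoid, and the upper-triangular action on the monomial basis `X₀^{r−j}X₁^{j}` read through the
  coordinates `F ↦ coeff_i F(1, X)`), applied to `y = (ιx)ᵀ` (same characteristic polynomial as `x`).
  Cancel `X − 1` in `k[X]`.
The tree's `SteinbergArtinRep` (permutation representation, stable lines vs eigenvectors, `#ℙ¹ = ℓ + 1`),
`SymmetricPowerBinaryForms` / `GL2ModularPrincipalSeriesSymPow` (`Sym^r`, dehomogenisation, evaluation) and
`FrobeniusTraceProofs` (Deligne's identity) are used BY NAME.  No definitions, no `native_decide`, no
Literature fact as a hypothesis, no `sorry`; axioms `propext`, `Classical.choice`, `Quot.sound`.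

Parts: `…SteinbergCongruenceSymPow.lean` (§C, `charpoly Sym^r`), `…SteinbergCongruenceProjectiveLine.lean`
(§A permutation matrices, §D the adapted basis of `k[ℙ¹(𝔽_ℓ)]`), this file (§B blocks, Deligne's identity
packaged, §E the item). -/

set_option linter.dupNamespace false -- project-wide option; `Summit.Langlands.Langlands.Theorems` is the mandated namespace, one namespace for the three parts

namespace Summit.Langlands.Langlands.Theorems.SteinbergArtinDedekindSteinbergCongruence

open Polynomial Matrix
open Literature.NumberTheory.GaloisRepresentations (permRep permRep_single augmentation trace_permRep)

/-! ### B. Block-diagonal bookkeeping and Deligne's trace identity -/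

section Blocks

variable {R : Type*} [CommRing R] {m n : Type*} [Fintype m] [Fintype n]

/-- Trace of a block matrix. [folklore] -/
theorem trace_fromBlocks' (A : Matrix m m R) (B : Matrix m n R) (C : Matrix n m R) (D : Matrix n n R) :
    (fromBlocks A B C D).trace = A.trace + D.trace := by
  simp [Matrix.trace, Fintype.sum_sum_type]

/-- `charpoly` of the `1 × 1` identity. [folklore] -/
theorem charpoly_one_unit : (1 : Matrix Unit Unit R).charpoly = X - C 1 := by
  rw [Matrix.charpoly, det_unique, charmatrix_apply_eq, one_apply_eq]

end Blocks

/-- **Deligne's identity packaged**: two complex square matrices of the same size with the same power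
traces `tr Aᵐ = tr Bᵐ` (`m ≥ 0`) have the same characteristic polynomial — `det(1 − tA)` is
`exp(−∑ tr(Aᵐ) tᵐ/m)`. [cite: Deligne1974, (1.5.3)] -/
theorem charpoly_eq_of_trace_pow_eq {ι ι' : Type*} [Fintype ι] [DecidableEq ι] [Fintype ι'] [DecidableEq ι']
    (A : Matrix ι ι ℂ) (B : Matrix ι' ι' ℂ) (hcard : Fintype.card ι = Fintype.card ι')
    (h : ∀ m : ℕ, (A ^ m).trace = (B ^ m).trace) : A.charpoly = B.charpoly := by
  have hL : (PowerSeries.mk fun m => (m : ℚ)⁻¹ • (A ^ m).trace : PowerSeries ℂ) =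
      PowerSeries.mk fun m => (m : ℚ)⁻¹ • (B ^ m).trace := by
    ext m
    rw [PowerSeries.coeff_mk, PowerSeries.coeff_mk, h]
  have h1 := Literature.AlgebraicGeometry.Motives.FrobeniusTrace.exp_subst_traceLogSeries_mul_charpolyRev A
  have h2 := Literature.AlgebraicGeometry.Motives.FrobeniusTrace.exp_subst_traceLogSeries_mul_charpolyRev B
  rw [hL, mul_comm] at h1
  have hrev : A.charpolyRev = B.charpolyRev := Polynomial.coe_inj.1 (left_inv_eq_right_inv h1 h2)
  have key : A.charpoly.reflect (Fintype.card ι) = B.charpoly.reflect (Fintype.card ι) := by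
    have e := A.reverse_charpoly.trans (hrev.trans B.reverse_charpoly.symm)
    unfold Polynomial.reverse at e
    rwa [A.charpoly_natDegree_eq_dim, B.charpoly_natDegree_eq_dim, ← hcard] at e
  rw [← Polynomial.reflect_reflect (N := Fintype.card ι) (p := A.charpoly), key, Polynomial.reflect_reflect]

/-! ### E. The item: three faces of the permutation matrix of `ρ̄(g)` on `ℙ¹(𝔽_ℓ)` -/

section Main

open scoped LinearAlgebra.Projectivization
open Literature.RepresentationTheory Literature.NumberTheory.GaloisRepresentations
open Summit.Langlands.Langlands.Theses.SteinbergArtinDedekind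

/-- **stmt-Langlands-11804 `SteinbergCongruence`** — the defining-characteristic congruence
`St_ℓ ∘ ρ̄ ≡ Sym^{ℓ−1} ρ̄ (mod ℓ)` on characteristic polynomials, with integrality.  Let `x = ρ̄(g)`
and `N_R ∈ M_{ℓ+1}(R)` the permutation matrix of `x` on `ℙ¹(𝔽_ℓ)` (entries in `{0,1}`, any `R`).
(ℂ) `tr N_ℂ^m = #Fix(x^m) = tr σ(g^m) + 1` by the Steinberg character hypothesis, so Deligne's
identity gives `charpoly N_ℂ = charpoly σ(g) · (X − 1)`; (ℤ) hence `Q := charpoly N_ℤ / (X − 1) ∈ ℤ[X]`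
maps to `charpoly σ(g)`; (k ⊇ 𝔽_ℓ) `charpoly N_k = charpoly N_k(x⁻¹)ᵀ` is computed in the adapted basis
`Ψ(Sym^{ℓ−1}) ⊕ k·𝟙` of `k[ℙ¹(𝔽_ℓ)]` as `charpoly Sym^{ℓ−1}((ι x)ᵀ) · (X − 1)
= ∏_{i=0}^{ℓ−1} (X − a^i b^{ℓ−1−i}) · (X − 1)`; cancel `X − 1`. [cite: Humphreys2005, §19.2 p.198] -/
theorem steinbergCongruence : SteinbergCongruence := by
  intro ℓ _ ρ σ hσ g
  classical
  haveI : Fintype (ℙ (ZMod ℓ) (Fin 2 → ZMod ℓ)) := Fintype.ofFinite _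
  have hℓ : 2 ≤ ℓ := (Fact.out : ℓ.Prime).two_le
  -- (ℂ) Deligne: `charpoly N_ℂ = charpoly σ(g) · (X − 1)`
  have hA : (LinearMap.toMatrix Finsupp.basisSingleOne Finsupp.basisSingleOne
        (permRep ℂ (GL (Fin 2) (ZMod ℓ)) (ℙ (ZMod ℓ) (Fin 2 → ZMod ℓ)) (ρ g))).charpoly =
      FramedRep.charpoly σ g * (X - C 1) := by
    have hB : (Matrix.fromBlocks ((σ g : GL (Fin ℓ) ℂ) : Matrix (Fin ℓ) (Fin ℓ) ℂ) 0 0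
        (1 : Matrix Unit Unit ℂ)).charpoly = FramedRep.charpoly σ g * (X - C 1) := by
      rw [Matrix.charpoly_fromBlocks_zero₁₂, charpoly_one_unit]
      rfl
    rw [← hB]
    refine charpoly_eq_of_trace_pow_eq _ _ ?_ (fun m => ?_)
    · rw [card_projectiveLine, Fintype.card_sum, Fintype.card_fin, Fintype.card_unit]
    · rw [trace_toMatrix_permRep_pow, Matrix.fromBlocks_diagonal_pow, trace_fromBlocks', one_pow, Matrix.trace_one,
        Fintype.card_unit, Nat.cast_one, ← map_pow ρ g m, ← Units.val_pow_eq_pow_val, ← map_pow σ g m,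
        hσ (g ^ m), nat_card_eigenvectors_eq' (K := ZMod ℓ) (ρ (g ^ m)), Nat.card_zmod]
      have hℓ1 : ((ℓ : ℂ) - 1) ≠ 0 := by
        rw [sub_ne_zero]
        exact_mod_cast (show ℓ ≠ 1 by omega)
      rw [Nat.cast_mul, Nat.cast_sub (by omega), Nat.cast_one, mul_div_assoc, div_self hℓ1, mul_one,
        sub_add_cancel]
  -- (k) the modular side: `charpoly N_k = (X − 1) · ∏ (X − a^i b^{ℓ−1−i})`
  have hC : ∀ (k : Type) [Field k] [Algebra (ZMod ℓ) k] (a b : k),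
      (FramedRep.charpoly ρ g).map (algebraMap (ZMod ℓ) k) = (X - C a) * (X - C b) →
      (LinearMap.toMatrix Finsupp.basisSingleOne Finsupp.basisSingleOne
        (permRep k (GL (Fin 2) (ZMod ℓ)) (ℙ (ZMod ℓ) (Fin 2 → ZMod ℓ)) (ρ g))).charpoly =
        (X - C 1) * ∏ i ∈ Finset.range ℓ, (X - C (a ^ i * b ^ (ℓ - 1 - i))) := by
    intro k _ _ a b hk
    obtain ⟨bs, hbs, hbs'⟩ := exists_basis_binaryForms (k := k) (ℓ - 1)
    obtain ⟨B, hB⟩ := exists_basis_toMatrix_permRep_eq_fromBlocks (k := k) (ρ g) bs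
    rw [← Matrix.charpoly_transpose, ← toMatrix_permRep_inv, LinearMap.charpoly_toMatrix,
      ← LinearMap.charpoly_toMatrix _ B, hB, Matrix.charpoly_fromBlocks_zero₁₂, charpoly_one_unit, mul_comm]
    have hy : ((((ρ g : GL (Fin 2) (ZMod ℓ)) : Matrix (Fin 2) (Fin 2) (ZMod ℓ)).map
        (algebraMap (ZMod ℓ) k))ᵀ).charpoly = (X - C a) * (X - C b) := by
      rw [Matrix.charpoly_transpose, Matrix.charpoly_map, ← hk]
      rfl
    rw [charpoly_toMatrix_symPow bs hbs hbs' _ a b hy, Nat.sub_add_cancel (by omega : 1 ≤ ℓ)]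
  -- (ℤ) integrality: the permutation matrix is defined over ℤ
  have hmap : ∀ (R : Type) [CommRing R],
      (LinearMap.toMatrix Finsupp.basisSingleOne Finsupp.basisSingleOne
        (permRep ℤ (GL (Fin 2) (ZMod ℓ)) (ℙ (ZMod ℓ) (Fin 2 → ZMod ℓ)) (ρ g))).charpoly.map (Int.castRingHom R) =
      (LinearMap.toMatrix Finsupp.basisSingleOne Finsupp.basisSingleOne
        (permRep R (GL (Fin 2) (ZMod ℓ)) (ℙ (ZMod ℓ) (Fin 2 → ZMod ℓ)) (ρ g))).charpoly := by
    intro R _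
    rw [← Matrix.charpoly_map, toMatrix_permRep_map]
  set P := (LinearMap.toMatrix Finsupp.basisSingleOne Finsupp.basisSingleOne
        (permRep ℤ (GL (Fin 2) (ZMod ℓ)) (ℙ (ZMod ℓ) (Fin 2 → ZMod ℓ)) (ρ g))).charpoly with hP
  have hroot : P.IsRoot 1 := by
    have h1 : (P.map (Int.castRingHom ℂ)).eval 1 = 0 := by
      rw [hmap ℂ, hA, Polynomial.eval_mul]
      simp
    rw [Polynomial.eval_one_map] at h1
    exact (Int.castRingHom ℂ).injective_int (by rwa [map_zero])
  have hQ : (X - C 1) * (P /ₘ (X - C 1)) = P := Polynomial.mul_divByMonic_eq_iff_isRoot.mpr hroot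
  refine ⟨P /ₘ (X - C 1), ?_, ?_⟩
  · have h := congrArg (Polynomial.map (Int.castRingHom ℂ)) hQ
    rw [Polynomial.map_mul, Polynomial.map_sub, Polynomial.map_X, Polynomial.map_C, map_one, hmap ℂ, hA,
      mul_comm] at h
    exact mul_right_cancel₀ (Polynomial.X_sub_C_ne_zero 1) h
  · intro k _ _ a b hk
    have h := congrArg (Polynomial.map (Int.castRingHom k)) hQ
    rw [Polynomial.map_mul, Polynomial.map_sub, Polynomial.map_X, Polynomial.map_C, map_one, hmap k,
      hC k a b hk] at h
    exact mul_left_cancel₀ (Polynomial.X_sub_C_ne_zero 1) h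

end Main

end Summit.Langlands.Langlands.Theorems.SteinbergArtinDedekindSteinbergCongruence
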